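import Summits.NavierStokesRegularity.NavierStokesRegularity.Theorems.ExtremiserTransienceNearExtremalTransiencePerFlowOfFilamentSelectionAllTime
import Summits.NavierStokesRegularity.NavierStokesRegularity.Theorems.ExtremiserTransienceBackwardConePropagation
import HarnessLib

/-!
# LINE g10-γ «multiscale-crowding» — crux `NearExtremalTransiencePerFlow` (item stmt-NavierStokesRegularity-26567)

Route `ExtremiserTransience`; ideator seat ns-idea-5, generation g10, technique card «extremal-example mining».
No summit is proved by a line; the crux, the heart T♭ below and NS regularity remain OPEN.

## Thesis of the line — the cut dictated by the METHOD CEILING of the dissipation ledger.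
The two other g10 lines close the non-compact branch of a selection dichotomy with a backward DISSIPATION LEDGER (α: ubiquity about one
centre; β: level chains of every length, thickness `g` fixed).  Mining the extremal examples OF THE LEDGER ITSELF (what is the sparsest level
geometry it can still overdraw?) gives its exact ceiling: at epoch `k` (time `36^k s`, length `L_k = 6^k √(-s)`) the ledger charges one quantum
`c·L_k` per `L_k`-SEPARATED level point, against a budget `E·R` on a cylinder of radius `R`; so it kills precisely the level sets whose
scale-summed one-dimensional content `Σ_k N(ℓ_k)·ℓ_k` (`N(ℓ)` = maximal number of `ℓ`-separated level points in the ball) exceeds `E·R/c`,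
i.e. sets that look AT LEAST ONE-DIMENSIONAL WITH DENSITY `C` ON `m ≫ 1` WELL-SEPARATED SCALES — and nothing sparser (a hierarchically dilute
set of box-dimension `< 1` has `Σ_k N(ℓ_k)ℓ_k = O(R)`, invisible to every energy ledger).  Chains (β) are the special case «all scales»;
coarse walks with steps `≤ L^θ`, `θ < 1`, and dilute hierarchies of dimension `> 1` are NOT chains but ARE killed.  Hence the optimal
division of labour between statics and dynamics on this crux is:

* T♭ `TightOrCrowding` (THE HEART, static): a near-extremal height-1 family with eventual linear growth has centres, a subsequence and a
  pointwise limit `W₀` of translates which is EITHER an exactly extremal extended slice (tight branch; closed by the landed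
  `not_isExtremalSlice_of_typeIAncientMild`) OR exhibits MULTISCALE CROWDING: for some density `C > 0` and level `η > 0`, for every number of
  scales `m` and every base scale `ℓ₀ > 0`, a ball `B̄(z₀, L)` and `m` scales `ℓ₀·6^{k₀} < ℓ₀·6^{k₁} < … ≤ L` at each of which the level set
  `{‖W₀‖ ≥ η} ∩ B̄(z₀,L)` contains `≥ C·L/ℓ` points pairwise `≥ ℓ` apart.  T♭ is implied by β's T♮ (chains crowd at every scale) and by α's
  C1 ∧ C2, and is STRICTLY WEAKER than both: it tolerates polynomially coarse dilution and asks for no connectedness at all.  It is the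
  weakest static statement any energy ledger can use (ceiling above), so a refutation of T♭ retires the whole ledger family, not one line.
* L3ᵐˢ `MultiscaleLedgerCount` — PROVED here (`multiscaleLedgerCount_holds`, no `sorry`): `m` crowded scales inside `B̄(x₀,L)` at time `s`,
  one-step backward propagation, the per-point spend and the cylinder budget are contradictory once `m > E(ρ+D+2)(2ρ+2D+2)/(Cc)`; the number
  of scales `m` is chosen BEFORE the measure, the predicate, the centre and the radius (this uniformity is what lets the static side ignore
  the dynamic constants: it must only supply crowding at EVERY `m, ℓ₀`).
* `LocalCrowdingLiouville` — PROVED here from L1ᵘ + L2 + L3ᵐˢ + the landed backward-cone propagation: for all `K, A, C > 0, η > 0, s < 0`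
  there are `m, ℓ₀ > 0` such that no slice `W s` of a Type-I ancient mild field with all-time linear growth `A` carries an `(m, ℓ₀, C, η)`
  crowding configuration.  Skeleton: `crux ⇐ T♭ ∧ L1ᵘ ∧ L2` (three registered stubs; heart T♭; L1ᵘ, L2 verbatim the β/α stubs).

## Why this line and not the thirteen on file.  It is the END OF THE LEDGER ROAD: the heart is the exact complement of the ledger's blind
spot, so (i) every ledger-type line (α, β, and any future «witness + backward budget» line) factors through it, (ii) its refutation would be
a structural no-go for the method family (a BC9 ceiling made into a statement), (iii) its proof obligation on the static side is the weakest
possible: «near-extremality + linear growth ⇒ tight, or ≥ 1-dimensional crowding on unboundedly many scales».  Levers by name: covering /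
packing numbers across scales (Frostman-type multiscale density) as the witness of the non-compact branch — new on this crux — + the
dissipation ledger in its sharp multiscale form.

## Registered stubs.  T♭ `stub_tightOrCrowding` (HEART, XL) · L1ᵘ `stub_uniformDissipationBudget` (L; verbatim β) · L2 `stub_violatorDissipation`
(M; verbatim α/β).  Proved here: `multiscaleLedgerCount_holds`, `localCrowdingLiouville_of`, the skeleton.

## Falsifiers / instrument.  Cheapest falsifier of T♭: a near-extremal sequence with linear growth whose every translate-limit is neither
extremal nor crowded on ≫ 1 scales — i.e. near-extremisers whose level sets are hierarchically dilute of box-dimension `< 1` at large scales.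
Instrument rows: «DILUTE-GAP» (kit j327037, pre-registered, reading DILUTION-MONOTONE: separating cells lowers the efficiency to the isolated
value; no gapped configuration beats the dense chain) and its FIRMING ROW (j327350).  Disproof record: no `Disproof.lean` for this crux or its
parent; negatives index (5 NS entries): none near.
-/


noncomputable section

open scoped Topology InnerProductSpace RealInnerProductSpace ENNReal ContDiff
open MeasureTheory Filter Set Metric Function
open Literature.Analysis Literature.Analysis.FluidPDE
open Summit.NavierStokesRegularity.NavierStokesRegularity.Theses.ExtremiserTransience
open Summit.NavierStokesRegularity.NavierStokesRegularity.Theorems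
open Summit.NavierStokesRegularity.NavierStokesRegularity.Theorems.DepletionLadder.KStar.HalfSpace
open Summit.NavierStokesRegularity.NavierStokesRegularity.Theorems.NearExtremalTransiencePerFlow.ZoneTransversality
open Summit.NavierStokesRegularity.NavierStokesRegularity.Theorems.NearExtremalTransiencePerFlow.MemberSelection
open Summit.NavierStokesRegularity.NavierStokesRegularity.Theorems.NearExtremalTransiencePerFlow

namespace Summit.NavierStokesRegularity.NavierStokesRegularity.Cruxes.NearExtremalTransiencePerFlow.MultiscaleCrowding

set_option linter.dupNamespace false

/-! ## §0 Vocabulary -/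

/-- LINEAR LOCAL-ENERGY GROWTH AT EVERY TIME of an ancient field (unit viscosity): `∫_{B(x,R)}‖W τ‖² ≤ A·R` for all `τ < 0`, all centres,
all radii (delivered for zoom limits by the landed G′ `growthTransferFlow`). -/
def HasLinGrowthAllTime (A : ℝ) (W : ℝ → E3 → E3) : Prop :=
  ∀ τ : ℝ, τ < 0 → ∀ (x : E3) (R : ℝ), 0 < R → ∫ z in Metric.ball x R, ‖W τ z‖ ^ 2 ≤ A * R

/-- The SPACE-TIME DISSIPATION MEASURE of `W : ℝ → ℝ³ → ℝ³`: Lebesgue measure on `ℝ × ℝ³` with density `‖∇W(τ)(x)‖²`. -/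
def dissMeasure (W : ℝ → E3 → E3) : Measure (ℝ × E3) :=
  (volume : Measure (ℝ × E3)).withDensity fun p => ‖fderiv ℝ (W p.1) p.2‖ₑ ^ 2

/-- A CROWDING CONFIGURATION with `m` scales over the base scale `ℓ₀`, density `C`, level `η`, for a field `w`: a centre `z₀`, a radius `L`
and distinct scale exponents `k 0 < k 1 < ⋯` such that each scale `ℓ_j := ℓ₀·6^{k j}` (`j < m`) is `≤ L` and the level set
`{‖w‖ ≥ η} ∩ B̄(z₀, L)` contains a finite set of at least `C·L/ℓ_j` points pairwise at distance `≥ ℓ_j`.  (Covering-number form of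
«one-dimensional with density `C` at scale `ℓ_j` inside `B̄(z₀,L)`»; the ratio `6` between admissible scales matches the ledger's epochs.) -/
def CrowdingConfig (m : ℕ) (ℓ₀ C η : ℝ) (w : E3 → E3) : Prop :=
  ∃ (z₀ : E3) (L : ℝ) (k : ℕ → ℕ), StrictMono k ∧ (∀ j : ℕ, j < m → ℓ₀ * 6 ^ (k j) ≤ L) ∧
    ∀ j : ℕ, j < m → ∃ S : Finset E3, C * L / (ℓ₀ * 6 ^ (k j)) ≤ (S.card : ℝ) ∧
      (∀ z ∈ S, ‖z - z₀‖ ≤ L ∧ η ≤ ‖w z‖) ∧ (∀ z ∈ S, ∀ z' ∈ S, z ≠ z' → ℓ₀ * 6 ^ (k j) ≤ ‖z - z'‖)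

/-- MULTISCALE CROWDING (density `C`, level `η`): crowding configurations with any number of scales over any base scale. -/
def MultiscaleCrowding (C η : ℝ) (w : E3 → E3) : Prop :=
  ∀ (m : ℕ) (ℓ₀ : ℝ), 0 < ℓ₀ → CrowdingConfig m ℓ₀ C η w

/-- Monotonicity in the density: crowding with density `C` is crowding with any smaller density. -/
theorem CrowdingConfig.mono {m : ℕ} {ℓ₀ C C' η : ℝ} {w : E3 → E3} (hℓ₀ : 0 < ℓ₀) (hCC' : C' ≤ C)
    (h : CrowdingConfig m ℓ₀ C η w) : CrowdingConfig m ℓ₀ C' η w := by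
  obtain ⟨z₀, L, k, hk, hkL, hS⟩ := h
  refine ⟨z₀, L, k, hk, hkL, fun j hj => ?_⟩
  obtain ⟨S, hcard, hmem, hsep⟩ := hS j hj
  refine ⟨S, le_trans ?_ hcard, hmem, hsep⟩
  rcases Nat.eq_zero_or_pos m with hm | hm
  · omega
  have hL : 0 ≤ L := by
    have h0 := hkL j hj
    have h1 : 0 < ℓ₀ * 6 ^ (k j) := by positivity
    linarith
  exact div_le_div_of_nonneg_right (mul_le_mul_of_nonneg_right hCC' hL) (by positivity)

/-! ### β's chains are a special case: T♮ ⇒ T♭ (kernel-checked comparison of the two hearts) -/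

/-- (Verbatim g10-β) A LEVEL CHAIN OF LENGTH `d` ABOUT `z₀` (thickness `g`, level `η`). -/
def ChainUpTo (g η : ℝ) (w : E3 → E3) (z₀ : E3) (d : ℝ) : Prop :=
  ∀ r : ℝ, 0 ≤ r → r ≤ d → ∃ z : E3, |‖z - z₀‖ - r| ≤ g ∧ η ≤ ‖w z‖

/-- (Verbatim g10-β) CHAINS OF EVERY LENGTH. -/
def ChainsOfEveryLength (g η : ℝ) (w : E3 → E3) : Prop :=
  ∀ d : ℝ, ∃ z₀ : E3, ChainUpTo g η w z₀ d

/-- **Chains crowd at every scale** (so β's non-tight branch implies γ's, with density `1/4`): from a chain of thickness `g` and length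
`L = ℓ₀6^{k₀+m}` about `z₀` one extracts, at each scale `ℓ = ℓ₀6^{k₀+j} ≥ 4g`, the points near the spheres of radii `0, 2ℓ, 4ℓ, …`
(`⌊L/4ℓ⌋ + 1` of them): they are `ℓ`-separated and lie in `B̄(z₀, L)`. -/
theorem multiscaleCrowding_of_chains {g η : ℝ} {w : E3 → E3} (h : ChainsOfEveryLength g η w) :
    MultiscaleCrowding (1 / 4) η w := by
  intro m ℓ₀ hℓ₀
  -- a first exponent `k₀` with `4 g ≤ ℓ₀ 6^{k₀}`
  obtain ⟨k₀, hk₀⟩ : ∃ k₀ : ℕ, 4 * g / ℓ₀ < 6 ^ k₀ := pow_unbounded_of_one_lt _ (by norm_num)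
  have hk₀' : 4 * g ≤ ℓ₀ * 6 ^ k₀ := by
    rw [div_lt_iff₀ hℓ₀] at hk₀; linarith
  -- the radius and the chain
  obtain ⟨L, hL⟩ : ∃ L : ℝ, L = ℓ₀ * 6 ^ (k₀ + m) := ⟨_, rfl⟩
  have hLpos : 0 < L := by rw [hL]; positivity
  obtain ⟨z₀, hch⟩ := h L
  refine ⟨z₀, L, fun j => k₀ + j, fun i j hij => by dsimp; omega, fun j hj => ?_, fun j hj => ?_⟩
  · rw [hL]
    exact mul_le_mul_of_nonneg_left (pow_le_pow_right₀ (by norm_num) (by dsimp only; omega)) hℓ₀.le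
  -- the scale `ℓ`
  obtain ⟨ℓ, hℓ⟩ : ∃ ℓ : ℝ, ℓ = ℓ₀ * 6 ^ (k₀ + j) := ⟨_, rfl⟩
  have hℓpos : 0 < ℓ := by rw [hℓ]; positivity
  have hgℓ : 4 * g ≤ ℓ := by
    rw [hℓ, pow_add, ← mul_assoc]
    exact hk₀'.trans (le_mul_of_one_le_right (by positivity) (one_le_pow₀ (by norm_num)))
  have hℓL : ℓ ≤ L := by
    rw [hℓ, hL]; exact mul_le_mul_of_nonneg_left (pow_le_pow_right₀ (by norm_num) (by omega)) hℓ₀.le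
  -- the number of points
  obtain ⟨n, hn⟩ : ∃ n : ℕ, n = ⌊L / (4 * ℓ)⌋₊ + 1 := ⟨_, rfl⟩
  have hnge : L / (4 * ℓ) ≤ (n : ℝ) := by
    rw [hn]; push_cast; exact (Nat.lt_floor_add_one _).le
  have hnle : ((n : ℝ) - 1) ≤ L / (4 * ℓ) := by
    rw [hn]; push_cast
    have := Nat.floor_le (show 0 ≤ L / (4 * ℓ) by positivity)
    linarith
  -- the points near the spheres of radii `2 i ℓ`, `i < n`
  have hrad : ∀ i : ℕ, i < n → (2 * (i : ℝ) * ℓ ≤ L / 2) := by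
    intro i hi
    have h1 : (i : ℝ) ≤ n - 1 := by
      have : (i : ℝ) + 1 ≤ n := by exact_mod_cast hi
      linarith
    have h2 : (i : ℝ) ≤ L / (4 * ℓ) := h1.trans hnle
    rw [le_div_iff₀ (by positivity)] at h2
    linarith
  have hz : ∀ i : ℕ, ∃ z : E3, i < n → |‖z - z₀‖ - 2 * i * ℓ| ≤ g ∧ η ≤ ‖w z‖ := by
    intro i
    by_cases hi : i < n
    · obtain ⟨z, h1, h2⟩ := hch (2 * i * ℓ) (by positivity) (by linarith [hrad i hi, hLpos])
      exact ⟨z, fun _ => ⟨h1, h2⟩⟩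
    · exact ⟨z₀, fun h' => absurd h' hi⟩
  choose z hz using hz
  -- separation of the points
  have hsep : ∀ i i' : ℕ, i < i' → i' < n → ℓ ≤ ‖z i - z i'‖ := by
    intro i i' hii' hi'
    have hi : i < n := hii'.trans hi'
    have h1 := abs_le.1 (hz i hi).1
    have h2 := abs_le.1 (hz i' hi').1
    have hic : (i : ℝ) + 1 ≤ i' := by exact_mod_cast hii'
    have h3 : ‖z i' - z₀‖ - ‖z i - z₀‖ ≤ ‖z i - z i'‖ := by
      have e : z i - z i' = (z i - z₀) - (z i' - z₀) := by abel
      rw [e, norm_sub_rev (z i - z₀) (z i' - z₀)]; exact norm_sub_norm_le _ _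
    nlinarith [h1.2, h2.1, hℓpos, hgℓ]
  have hinj : Set.InjOn z ↑(Finset.range n) := by
    intro i hi i' hi' hzz
    have hi := Finset.mem_range.1 (Finset.mem_coe.1 hi)
    have hi' := Finset.mem_range.1 (Finset.mem_coe.1 hi')
    by_contra hne
    rcases lt_or_gt_of_ne hne with hlt | hgt
    · have h := hsep i i' hlt hi'
      rw [hzz, sub_self, norm_zero] at h
      linarith
    · have h := hsep i' i hgt hi
      rw [hzz, sub_self, norm_zero] at h
      linarith
  refine ⟨(Finset.range n).image z, ?_, ?_, ?_⟩
  · rw [Finset.card_image_of_injOn hinj, Finset.card_range, ← hℓ]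
    calc 1 / 4 * L / ℓ = L / (4 * ℓ) := by field_simp
      _ ≤ n := hnge
  · intro x hx
    obtain ⟨i, hi, rfl⟩ := Finset.mem_image.1 hx
    have hi' := Finset.mem_range.1 hi
    refine ⟨?_, (hz i hi').2⟩
    have h1 := (abs_le.1 (hz i hi').1).2
    linarith [hrad i hi', hgℓ, hℓL, hLpos]
  · intro x hx x' hx' hxx
    obtain ⟨i, hi, rfl⟩ := Finset.mem_image.1 hx
    obtain ⟨i', hi', rfl⟩ := Finset.mem_image.1 hx'
    have hin := Finset.mem_range.1 hi
    have hin' := Finset.mem_range.1 hi'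
    rw [← hℓ]
    rcases lt_trichotomy i i' with hlt | heq | hgt
    · exact hsep i i' hlt hin'
    · exact absurd (by rw [heq]) hxx
    · rw [norm_sub_rev]; exact hsep i' i hgt hin

/-- Radial UBIQUITY about one centre (g10-α's witness, the conclusion of its C1 ∧ C2 for the limit slice) gives chains of every length about
that centre, hence multiscale crowding with density `1/4`: so α's heart also implies T♭ (no sign condition on `g` is needed:
for `g < 0` the chain hypothesis is vacuous-false, for `g = 0` the level set contains whole spheres). -/
theorem multiscaleCrowding_of_ubiquity {g η : ℝ} {w : E3 → E3} {z₀ : E3}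
    (h : ∀ r : ℝ, 0 ≤ r → ∃ z : E3, |‖z - z₀‖ - r| ≤ g ∧ η ≤ ‖w z‖) : MultiscaleCrowding (1 / 4) η w :=
  multiscaleCrowding_of_chains fun _ => ⟨z₀, fun r hr _ => h r hr⟩

/-! ## §1 The statements of the line (L3ᵐˢ and the local crowding Liouville theorem are PROVED in §2; T♭, L1ᵘ, L2 are the stubs of §3) -/

/-- (L1ᵘ — provable, L) UNIFORM DISSIPATION BUDGET: for all `K, A` there is `E = E(K,A)` such that every Type-I ancient mild field (constant `K`)
with all-time linear growth `A` dissipates at most `E·R` in every parabolic cylinder `[τ₁,τ₂] × B(x,R)` with `-τ₁ ≤ R²` (`τ₁ < τ₂ < 0`).  Local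
energy inequality on the classical windows (`IsTypeIAncientMild.exists_isClassicalNSSolutionOn_Ioo`) with a cut-off adapted to `B(x,2R)`:
initial energy `≤ 2AR`; `|W|²Δφ`-term `≤ 2AR`; cubic flux `≤ 4AKR`; pressure = Riesz pressure mod constants
(`pressure_eq_pressurePotentialMod_add_const`), near part like the cubic term, far part `∇p_far = O(KA/(R²√(-τ)))`; every constant depends on
`K, A` only.  Why it might fail: it does not (KNSS-class local energy theory); size is the only risk.  It implies g10-α's `DissipationBudget`. -/
def UniformDissipationBudget : Prop :=
  ∀ (K A : ℝ), ∃ E : ℝ, ∀ (W : ℝ → E3 → E3), IsTypeIAncientMild K W → HasLinGrowthAllTime A W →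
    ∀ (x : E3) (R τ₁ τ₂ : ℝ), 0 < R → τ₁ < τ₂ → τ₂ < 0 → -τ₁ ≤ R ^ 2 →
      dissMeasure W (Set.Icc τ₁ τ₂ ×ˢ Metric.ball x R) ≤ ENNReal.ofReal (E * R)

/-- (L2 — provable, M; verbatim the g10-α stub) A LEVEL POINT SPENDS DISSIPATION: for `K, A, ε > 0` there are `c, D > 0` and `0 < a < 1` such
that for every Type-I ancient mild field `W` (constant `K`) with all-time linear growth `A`, every level point `√(-τ)‖W τ x‖ > ε` forces
`∬_{[(1+a)τ, τ] × B(x, D√(-τ))} ‖∇W‖² ≥ c√(-τ)` (derivative bounds keep the level on a parabolic box; linear growth makes the spherical mean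
small at radius `D√(-τ)`; the radial drop costs Dirichlet energy by Cauchy–Schwarz).  Why it might fail: it does not; the constants are explicit. -/
def ViolatorDissipation : Prop :=
  ∀ (K A ε : ℝ), 0 < ε → ∃ (c D a : ℝ), 0 < c ∧ 0 < D ∧ 0 < a ∧ a < 1 ∧
    ∀ (W : ℝ → E3 → E3), IsTypeIAncientMild K W → HasLinGrowthAllTime A W →
      ∀ (τ : ℝ) (x : E3), τ < 0 → ε < Real.sqrt (-τ) * ‖W τ x‖ →
        ENNReal.ofReal (c * Real.sqrt (-τ)) ≤
          dissMeasure W (Set.Icc ((1 + a) * τ) τ ×ˢ Metric.ball x (D * Real.sqrt (-τ)))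

/-- (L3ᵐˢ — PROVED below, `multiscaleLedgerCount_holds`) THE MULTISCALE LEDGER COUNT.  Constants `s < 0`, `ρ, c, D > 0`, `0 < a < 1`, `E`,
density `C > 0`; base scale `ℓ₀ := (2ρ + 2D + 2)√(-s)`.  There is a NUMBER OF SCALES `m` (depending on these constants only) such that for
every measure `μ`, predicate `P`, centre `x₀`, radius `L` and distinct exponents `k`: (Crowd) at each of the `m` scales `ℓ₀ 6^{k j} ≤ L` a
finite `ℓ₀6^{k j}`-separated set of `≥ C·L/(ℓ₀ 6^{k j})` `P`-points at time `s` in `B̄(x₀, L)`, (Per) one-step backward propagation with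
drift `ρ√(-τ)`, (Spend) `c√(-τ)` per `P`-point on its box, (Budget) `μ([τ₁,τ₂] × B(x₀,R)) ≤ E·R` whenever `-τ₁ ≤ R²` — are contradictory. -/
def MultiscaleLedgerCount : Prop :=
  ∀ (s ρ c D a E C : ℝ), s < 0 → 0 < ρ → 0 < c → 0 < D → 0 < a → a < 1 → 0 < C →
    ∃ m : ℕ, ∀ (μ : Measure (ℝ × E3)) (P : ℝ → E3 → Prop) (x₀ : E3) (L : ℝ) (k : ℕ → ℕ),
      StrictMono k →
      (∀ j : ℕ, j < m → (2 * ρ + 2 * D + 2) * Real.sqrt (-s) * 6 ^ (k j) ≤ L) →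
      (∀ j : ℕ, j < m → ∃ S : Finset E3,
          C * L / ((2 * ρ + 2 * D + 2) * Real.sqrt (-s) * 6 ^ (k j)) ≤ (S.card : ℝ) ∧
          (∀ z ∈ S, ‖z - x₀‖ ≤ L ∧ P s z) ∧
          (∀ z ∈ S, ∀ z' ∈ S, z ≠ z' → (2 * ρ + 2 * D + 2) * Real.sqrt (-s) * 6 ^ (k j) ≤ ‖z - z'‖)) →
      (∀ (τ : ℝ) (x : E3), τ < 0 → P τ x → ∃ x' : E3, ‖x' - x‖ ≤ ρ * Real.sqrt (-τ) ∧ P (36 * τ) x') →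
      (∀ (τ : ℝ) (x : E3), τ < 0 → P τ x →
        ENNReal.ofReal (c * Real.sqrt (-τ)) ≤ μ (Set.Icc ((1 + a) * τ) τ ×ˢ Metric.ball x (D * Real.sqrt (-τ)))) →
      (∀ (R τ₁ τ₂ : ℝ), 0 < R → τ₁ < τ₂ → τ₂ < 0 → -τ₁ ≤ R ^ 2 →
        μ (Set.Icc τ₁ τ₂ ×ˢ Metric.ball x₀ R) ≤ ENNReal.ofReal (E * R)) →
      False

/-- (THE LOCAL CROWDING LIOUVILLE THEOREM — kernel-checked below from L1ᵘ, L2, L3ᵐˢ and the landed backward-cone propagation): for all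
`K, A, C > 0, η > 0, s < 0` there are a number of scales `m` and a base scale `ℓ₀ > 0` such that NO slice `W s` of a Type-I ancient mild field
(constant `K`) with all-time linear growth `A` carries an `(m, ℓ₀, C, η)` crowding configuration.  It implies β's `LocalChainLiouville` and
α's `UbiquitousSliceLiouville`, and kills by name every limit in the non-tight branch of T♭. -/
def LocalCrowdingLiouville : Prop :=
  ∀ (K A C η s : ℝ), s < 0 → 0 < C → 0 < η → ∃ (m : ℕ) (ℓ₀ : ℝ), 0 < ℓ₀ ∧ ∀ (W : ℝ → E3 → E3),
    IsTypeIAncientMild K W → HasLinGrowthAllTime A W → ¬ CrowdingConfig m ℓ₀ C η (W s)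

/-- (T♭ — THE HEART, XL) TIGHT-OR-CROWDING: a near-extremal height-`1` family (`NearExtremalFamily v Λ Θ ε`) whose members eventually have
linear local-energy growth `A` admits centres `y`, a subsequence `φ` and a pointwise limit `W₀` of the translates `v (φ n) (y (φ n) + ·)`
such that EITHER `W₀` is an exactly extremal extended slice (`IsExtremalSlice`, the tight branch of concentration-compactness) OR `W₀` exhibits
multiscale crowding with some density `C > 0` at some level `η > 0` (the non-tight branch, in the weakest form an energy ledger can use).
Mechanism: as for β's T♮ (tight profiles ⇒ `C^∞_loc` convergence + `extendedSharp` + Fatou ⇒ extremal limit; no tight centring ⇒ the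
Cauchy–Schwarz weight delocalises over unboundedly many unit cells confined by linear growth), but the conclusion asked of the delocalised
branch is only COUNTING: `≥ C·L/ℓ` cells that are `ℓ`-separated in a ball of radius `L`, on `m` scales, for every `m` — no connectedness, no
fixed thickness.  Implied by T♮ (β) and by C1 ∧ C2 (α).  Why it might fail: near-extremisers whose level sets are hierarchically dilute of
box-dimension `< 1` (the one geometry no ledger sees); the DILUTE-GAP rows (j327037: DILUTION-MONOTONE) are the instrument.  Sources: Lions'
concentration-compactness (1984); Frostman / multiscale covering numbers; this crux's `Lines/tight_or_chain.lean`, `Lines/dissipation_ledger.lean`. -/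
def TightOrCrowding : Prop :=
  ∀ (v : ℕ → E3 → E3) (Λ : ℕ → ℝ) (Θ : ℝ) (ε : ℕ → ℝ) (A : ℝ),
    NearExtremalFamily v Λ Θ ε →
    (∀ᶠ n in atTop, ∀ (x : E3) (R : ℝ), 0 < R → ∫ z in Metric.ball x R, ‖v n z‖ ^ 2 ≤ A * R) →
    ∃ (y : ℕ → E3) (φ : ℕ → ℕ) (W₀ : E3 → E3), StrictMono φ ∧
      (∀ z : E3, Tendsto (fun n => v (φ n) (y (φ n) + z)) atTop (𝓝 (W₀ z))) ∧
      (IsExtremalSlice W₀ ∨ ∃ C η : ℝ, 0 < C ∧ 0 < η ∧ MultiscaleCrowding C η W₀)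

/-! ## §1b T♭ at member level and the kernel-checked limit passage `tightOrCrowding_of_members` -/

/-- Equi-Lipschitz from the first-derivative bound (verbatim g10-β). -/
theorem lipschitz_of_iteratedFDeriv_one {f : E3 → E3} {Λ₁ : ℝ} (hf : ContDiff ℝ (⊤ : ℕ∞) f)
    (hΛ : ∀ x, ‖iteratedFDeriv ℝ 1 f x‖ ≤ Λ₁) (a b : E3) : ‖f a - f b‖ ≤ Λ₁ * ‖a - b‖ := by
  have hdiff : ∀ x ∈ (Set.univ : Set E3), DifferentiableAt ℝ f x := fun x _ =>
    (hf.differentiable (by simp)).differentiableAt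
  have hbound : ∀ x ∈ (Set.univ : Set E3), ‖fderiv ℝ f x‖ ≤ Λ₁ := by
    intro x _
    have h : ‖fderiv ℝ f x‖ = ‖iteratedFDeriv ℝ 1 f x‖ := by
      rw [← norm_iteratedFDeriv_fderiv, norm_iteratedFDeriv_zero]
    rw [h]; exact hΛ x
  exact convex_univ.norm_image_sub_le_of_norm_fderiv_le hdiff hbound (Set.mem_univ b) (Set.mem_univ a)

/-- **Finite separated level sets pass to the limit** (Bolzano–Weierstrass in `Fin N → ℝ³` + equi-Lipschitz): if eventually every member
`v n` has `N` points in `B̄(y n, L)` at level `≥ η`, pairwise `≥ ℓ > 0` apart, then the pointwise limit `w` of the translates `v n (y n + ·)`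
has `N` such points in `B̄(0, L)` (same level, same separation). -/
theorem separated_points_of_limit (v : ℕ → E3 → E3) (Λ₁ L ℓ η : ℝ) (y : ℕ → E3) (w : E3 → E3) (N : ℕ)
    (hcd : ∀ n, ContDiff ℝ (⊤ : ℕ∞) (v n)) (hΛ : ∀ n (x : E3), ‖iteratedFDeriv ℝ 1 (v n) x‖ ≤ Λ₁) (hℓ : 0 < ℓ)
    (hS : ∀ᶠ n in atTop, ∃ S : Finset E3, N ≤ S.card ∧ (∀ z ∈ S, ‖z - y n‖ ≤ L ∧ η ≤ ‖v n z‖) ∧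
      (∀ z ∈ S, ∀ z' ∈ S, z ≠ z' → ℓ ≤ ‖z - z'‖))
    (hconv : ∀ z : E3, Tendsto (fun n => v n (y n + z)) atTop (𝓝 (w z))) :
    ∃ S : Finset E3, S.card = N ∧ (∀ z ∈ S, ‖z‖ ≤ L ∧ η ≤ ‖w z‖) ∧
      (∀ z ∈ S, ∀ z' ∈ S, z ≠ z' → ℓ ≤ ‖z - z'‖) := by
  rcases Nat.eq_zero_or_pos N with hN | hN
  · exact ⟨∅, by simp [hN], by simp, by simp⟩
  obtain ⟨φ₀, hφ₀, hP⟩ := extraction_of_eventually_atTop hS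
  choose S hS using hP
  -- sub-finsets of exact cardinality `N`, enumerated by `Fin N`
  have ht : ∀ n, ∃ t : Finset E3, t ⊆ S n ∧ t.card = N := fun n => Finset.exists_subset_card_eq (hS n).1
  choose t htS htc using ht
  obtain ⟨p, hp⟩ : ∃ p : ℕ → Fin N → E3, ∀ n i, p n i = ((t n).equivFin.symm (Fin.cast (htc n).symm i) : E3) :=
    ⟨_, fun _ _ => rfl⟩
  have hpmem : ∀ n i, p n i ∈ S n := fun n i => by rw [hp]; exact htS n (Subtype.coe_prop _)
  have hpinj : ∀ n i i', i ≠ i' → p n i ≠ p n i' := by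
    intro n i i' hii' h
    rw [hp, hp] at h
    have h1 := (t n).equivFin.symm.injective (Subtype.ext h)
    exact hii' (Fin.cast_injective _ h1)
  -- `L ≥ 0` (there is a point), and the relative positions live in a compact set of `Fin N → ℝ³`
  have hL : 0 ≤ L := by
    have h := ((hS 0).2.1 (p 0 ⟨0, hN⟩) (hpmem 0 _)).1
    exact (norm_nonneg _).trans h
  obtain ⟨x, hx⟩ : ∃ x : ℕ → Fin N → E3, ∀ n i, x n i = p n i - y (φ₀ n) := ⟨_, fun _ _ => rfl⟩
  have hxmem : ∀ n, x n ∈ Metric.closedBall (0 : Fin N → E3) L := by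
    intro n
    rw [Metric.mem_closedBall, dist_zero_right, pi_norm_le_iff_of_nonneg hL]
    intro i
    rw [hx]; exact ((hS n).2.1 (p n i) (hpmem n i)).1
  obtain ⟨a, ha, ψ, hψ, hxa⟩ := (isCompact_closedBall (0 : Fin N → E3) L).tendsto_subseq hxmem
  have hxi : ∀ i, Tendsto (fun n => x (ψ n) i) atTop (𝓝 (a i)) := fun i => tendsto_pi_nhds.1 hxa i
  -- each limit position: in the ball, at level `≥ η`
  have hai_norm : ∀ i, ‖a i‖ ≤ L := fun i => by
    have h := ha; rw [Metric.mem_closedBall, dist_zero_right] at h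
    exact (norm_le_pi_norm a i).trans h
  have hai_lev : ∀ i, η ≤ ‖w (a i)‖ := by
    intro i
    have hconv' : Tendsto (fun n => ‖v (φ₀ (ψ n)) (y (φ₀ (ψ n)) + a i)‖) atTop (𝓝 ‖w (a i)‖) :=
      ((hconv (a i)).comp ((hφ₀.comp hψ).tendsto_atTop)).norm
    have hlow : Tendsto (fun n => η - Λ₁ * ‖a i - x (ψ n) i‖) atTop (𝓝 η) := by
      have h1 : Tendsto (fun n => a i - x (ψ n) i) atTop (𝓝 (a i - a i)) := tendsto_const_nhds.sub (hxi i)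
      rw [sub_self] at h1
      have h2 : Tendsto (fun n => ‖a i - x (ψ n) i‖) atTop (𝓝 0) := by simpa using h1.norm
      have h3 : Tendsto (fun n => η - Λ₁ * ‖a i - x (ψ n) i‖) atTop (𝓝 (η - Λ₁ * 0)) :=
        tendsto_const_nhds.sub (tendsto_const_nhds.mul h2)
      simpa using h3
    have hle : ∀ n, η - Λ₁ * ‖a i - x (ψ n) i‖ ≤ ‖v (φ₀ (ψ n)) (y (φ₀ (ψ n)) + a i)‖ := by
      intro n
      have hlip := lipschitz_of_iteratedFDeriv_one (hcd (φ₀ (ψ n))) (hΛ (φ₀ (ψ n)))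
        (y (φ₀ (ψ n)) + a i) (p (ψ n) i)
      have e1 : y (φ₀ (ψ n)) + a i - p (ψ n) i = a i - x (ψ n) i := by rw [hx]; abel
      rw [e1] at hlip
      have hη := ((hS (ψ n)).2.1 (p (ψ n) i) (hpmem (ψ n) i)).2
      have htri : ‖v (φ₀ (ψ n)) (p (ψ n) i)‖ - ‖v (φ₀ (ψ n)) (y (φ₀ (ψ n)) + a i) - v (φ₀ (ψ n)) (p (ψ n) i)‖ ≤
          ‖v (φ₀ (ψ n)) (y (φ₀ (ψ n)) + a i)‖ := by
        have := norm_sub_norm_le (v (φ₀ (ψ n)) (p (ψ n) i)) (v (φ₀ (ψ n)) (y (φ₀ (ψ n)) + a i))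
        rw [norm_sub_rev] at this
        linarith
      linarith
    exact le_of_tendsto_of_tendsto' hlow hconv' hle
  -- pairwise separation of the limit positions
  have hsep : ∀ i i', i ≠ i' → ℓ ≤ ‖a i - a i'‖ := by
    intro i i' hii'
    have h1 : Tendsto (fun n => ‖x (ψ n) i - x (ψ n) i'‖) atTop (𝓝 ‖a i - a i'‖) := ((hxi i).sub (hxi i')).norm
    refine ge_of_tendsto' h1 fun n => ?_
    have e : x (ψ n) i - x (ψ n) i' = p (ψ n) i - p (ψ n) i' := by rw [hx, hx]; abel
    rw [e]
    exact (hS (ψ n)).2.2 _ (hpmem _ _) _ (hpmem _ _) (hpinj _ i i' hii')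
  have hainj : Function.Injective a := by
    intro i i' h
    by_contra hii'
    have h1 := hsep i i' hii'
    rw [h, sub_self, norm_zero] at h1
    linarith
  refine ⟨Finset.univ.image a, ?_, ?_, ?_⟩
  · rw [Finset.card_image_of_injective _ hainj, Finset.card_univ, Fintype.card_fin]
  · intro z hz
    obtain ⟨i, -, rfl⟩ := Finset.mem_image.1 hz
    exact ⟨hai_norm i, hai_lev i⟩
  · intro z hz z' hz' hzz
    obtain ⟨i, -, rfl⟩ := Finset.mem_image.1 hz
    obtain ⟨i', -, rfl⟩ := Finset.mem_image.1 hz'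
    exact hsep i i' fun h => hzz (by rw [h])

/-- **T♭ at MEMBER level** (what a prover actually establishes): the same dichotomy, with the crowding branch stated on the MEMBERS about the
centres `y (φ n)`: for every `m, ℓ₀ > 0` a radius `L` and exponents `k` (independent of `n`) such that, scale by scale, EVENTUALLY every
member carries the separated level points in `B̄(y (φ n), L)`. -/
def TightOrCrowdingMembers : Prop :=
  ∀ (v : ℕ → E3 → E3) (Λ : ℕ → ℝ) (Θ : ℝ) (ε : ℕ → ℝ) (A : ℝ),
    NearExtremalFamily v Λ Θ ε →
    (∀ᶠ n in atTop, ∀ (x : E3) (R : ℝ), 0 < R → ∫ z in Metric.ball x R, ‖v n z‖ ^ 2 ≤ A * R) →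
    ∃ (y : ℕ → E3) (φ : ℕ → ℕ) (W₀ : E3 → E3), StrictMono φ ∧
      (∀ z : E3, Tendsto (fun n => v (φ n) (y (φ n) + z)) atTop (𝓝 (W₀ z))) ∧
      (IsExtremalSlice W₀ ∨ ∃ C η : ℝ, 0 < C ∧ 0 < η ∧ ∀ (m : ℕ) (ℓ₀ : ℝ), 0 < ℓ₀ →
        ∃ (L : ℝ) (k : ℕ → ℕ), StrictMono k ∧ (∀ j : ℕ, j < m → ℓ₀ * 6 ^ (k j) ≤ L) ∧
          ∀ j : ℕ, j < m → ∀ᶠ n in atTop, ∃ S : Finset E3, C * L / (ℓ₀ * 6 ^ (k j)) ≤ (S.card : ℝ) ∧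
            (∀ z ∈ S, ‖z - y (φ n)‖ ≤ L ∧ η ≤ ‖v (φ n) z‖) ∧
            (∀ z ∈ S, ∀ z' ∈ S, z ≠ z' → ℓ₀ * 6 ^ (k j) ≤ ‖z - z'‖))

/-- **Kernel-checked reduction T♭ ⇐ T♭ₘₑₘ**: the limit passage of the crowding branch, scale by scale, by `separated_points_of_limit`
(with the family's uniform gradient bound `Λ 1`); the limit configuration sits about the origin of the moving frame. -/
theorem tightOrCrowding_of_members (h : TightOrCrowdingMembers) : TightOrCrowding := by
  intro v Λ Θ ε A hfam hgr
  obtain ⟨y, φ, W₀, hφ, hconv, hdich⟩ := h v Λ Θ ε A hfam hgr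
  refine ⟨y, φ, W₀, hφ, hconv, ?_⟩
  rcases hdich with hext | ⟨C, η, hC, hη, hcrowd⟩
  · exact Or.inl hext
  · right
    refine ⟨C, η, hC, hη, fun m ℓ₀ hℓ₀ => ?_⟩
    obtain ⟨L, k, hk, hkL, hconf⟩ := hcrowd m ℓ₀ hℓ₀
    refine ⟨0, L, k, hk, hkL, fun j hj => ?_⟩
    have hcd : ∀ n, ContDiff ℝ (⊤ : ℕ∞) (v (φ n)) := fun n => hfam.1 (φ n)
    have hΛ : ∀ n (x : E3), ‖iteratedFDeriv ℝ 1 (v (φ n)) x‖ ≤ Λ 1 := fun n x => hfam.2.2.2.1 1 (φ n) x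
    have hℓ : 0 < ℓ₀ * 6 ^ (k j) := by positivity
    -- the required number of points, as a natural number
    obtain ⟨N, hN⟩ : ∃ N : ℕ, N = ⌈C * L / (ℓ₀ * 6 ^ (k j))⌉₊ := ⟨_, rfl⟩
    have hSN : ∀ᶠ n in atTop, ∃ S : Finset E3, N ≤ S.card ∧ (∀ z ∈ S, ‖z - y (φ n)‖ ≤ L ∧ η ≤ ‖v (φ n) z‖) ∧
        (∀ z ∈ S, ∀ z' ∈ S, z ≠ z' → ℓ₀ * 6 ^ (k j) ≤ ‖z - z'‖) := by
      filter_upwards [hconf j hj] with n ⟨S, hcard, hmem, hsep⟩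
      exact ⟨S, by rw [hN]; exact Nat.ceil_le.2 hcard, hmem, hsep⟩
    obtain ⟨S, hScard, hSmem, hSsep⟩ := separated_points_of_limit (fun n => v (φ n)) (Λ 1) L (ℓ₀ * 6 ^ (k j)) η
      (fun n => y (φ n)) W₀ N hcd hΛ hℓ hSN hconv
    refine ⟨S, ?_, fun z hz => ⟨by simpa using (hSmem z hz).1, (hSmem z hz).2⟩, hSsep⟩
    rw [hScard, hN]; exact Nat.le_ceil _

/-! ## §2 The proofs: L3ᵐˢ (multiscale packing) and the local crowding Liouville theorem -/

/-- **Local crowding Liouville from the multiscale ledger.**  Level `ε = min(ε₁, η√(-s)/2)`; `m` from L3ᵐˢ; `ℓ₀ = (2ρ+2D+2)√(-s)`. -/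
theorem localCrowdingLiouville_of_ledger (h3 : MultiscaleLedgerCount) (h1 : UniformDissipationBudget) (h2 : ViolatorDissipation) :
    LocalCrowdingLiouville := by
  intro K A C η s hs hC hη
  obtain ⟨ε₁, hε₁, hper⟩ := ScrewSymmetricLiouville.exists_backwardCone_violator
  have hsq : 0 < Real.sqrt (-s) := Real.sqrt_pos.2 (neg_pos.2 hs)
  obtain ⟨ε, hε, hεε₁, hεη⟩ : ∃ ε : ℝ, 0 < ε ∧ ε ≤ ε₁ ∧ ε < η * Real.sqrt (-s) := by
    refine ⟨min ε₁ (η * Real.sqrt (-s) / 2), lt_min hε₁ (by positivity), min_le_left _ _, ?_⟩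
    have h1 : η * Real.sqrt (-s) / 2 < η * Real.sqrt (-s) := half_lt_self (by positivity)
    exact lt_of_le_of_lt (min_le_right _ _) h1
  obtain ⟨ρ, hρ, hρW⟩ := hper ε hε hεε₁ K
  obtain ⟨c, D, a, hc, hD, ha, ha1, hsp⟩ := h2 K A ε hε
  obtain ⟨E, hE⟩ := h1 K A
  obtain ⟨m, hcount⟩ := h3 s ρ c D a E C hs hρ hc hD ha ha1 hC
  refine ⟨m, (2 * ρ + 2 * D + 2) * Real.sqrt (-s), by positivity, fun W hW hgr hconf => ?_⟩
  obtain ⟨z₀, L, k, hk, hkL, hS⟩ := hconf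
  refine hcount (dissMeasure W) (fun τ x => ε < Real.sqrt (-τ) * ‖W τ x‖) z₀ L k hk hkL ?_ ?_ ?_ ?_
  · intro j hj
    obtain ⟨S, hcard, hmem, hsep⟩ := hS j hj
    refine ⟨S, hcard, fun z hz => ⟨(hmem z hz).1, ?_⟩, hsep⟩
    show ε < Real.sqrt (-s) * ‖W s z‖
    calc ε < η * Real.sqrt (-s) := hεη
      _ = Real.sqrt (-s) * η := mul_comm _ _
      _ ≤ Real.sqrt (-s) * ‖W s z‖ := by gcongr; exact (hmem z hz).2
  · intro τ x hτ hP
    exact hρW W hW τ hτ x hP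
  · intro τ x hτ hP
    exact hsp W hW hgr τ x hτ hP
  · intro R τ₁ τ₂ hR h12 h2' hτR
    exact hE W hW hgr z₀ R τ₁ τ₂ hR h12 h2' hτR

set_option maxHeartbeats 1600000 in
/-- **L3ᵐˢ is a THEOREM** (elementary multiscale packing, kernel-checked; no `sorry`). -/
theorem multiscaleLedgerCount_holds : MultiscaleLedgerCount := by
  intro s ρ c D a E C hs hρ hc hD ha ha1 hC
  -- ### scales: `L0 = √(-s)`, epoch lengths `Lk k = 6^k L0`, epoch times `τ k = 36^k s`, separation factor `κ₀ = 2ρ+2D+2`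
  obtain ⟨L0, hL0⟩ : ∃ L0 : ℝ, L0 = Real.sqrt (-s) := ⟨_, rfl⟩
  have hL0pos : 0 < L0 := by rw [hL0]; exact Real.sqrt_pos.2 (neg_pos.2 hs)
  have hL0sq : L0 ^ 2 = -s := by rw [hL0]; exact Real.sq_sqrt (neg_pos.2 hs).le
  obtain ⟨Lk, hL⟩ : ∃ Lk : ℕ → ℝ, ∀ k, Lk k = 6 ^ k * L0 := ⟨_, fun _ => rfl⟩
  obtain ⟨τ, hτ⟩ : ∃ τ : ℕ → ℝ, ∀ k, τ k = 36 ^ k * s := ⟨_, fun _ => rfl⟩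
  have hLpos : ∀ k, 0 < Lk k := fun k => by rw [hL]; positivity
  have hτneg : ∀ k, τ k < 0 := fun k => by rw [hτ]; exact mul_neg_of_pos_of_neg (by positivity) hs
  have h36 : ∀ k : ℕ, (36 : ℝ) ^ k = (6 ^ k) ^ 2 := fun k => by
    rw [← pow_mul, mul_comm, pow_mul]; norm_num
  have hsqrtτ : ∀ k, Real.sqrt (-(τ k)) = Lk k := by
    intro k
    rw [hτ, hL, hL0, show -(36 ^ k * s) = ((6 : ℝ) ^ k) ^ 2 * (-s) by rw [h36]; ring,
      Real.sqrt_mul (sq_nonneg _), Real.sqrt_sq (by positivity)]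
  have hLsq : ∀ k, Lk k ^ 2 = -(τ k) := fun k => by
    rw [hL, hτ, mul_pow, ← h36, hL0sq]; ring
  have hLmono : ∀ {k k' : ℕ}, k ≤ k' → Lk k ≤ Lk k' := by
    intro k k' hkk'
    rw [hL, hL]
    exact mul_le_mul_of_nonneg_right (pow_le_pow_right₀ (by norm_num) hkk') hL0pos.le
  have hτmono : ∀ {k k' : ℕ}, k ≤ k' → τ k' ≤ τ k := by
    intro k k' hkk'
    rw [hτ, hτ]
    exact mul_le_mul_of_nonpos_right (pow_le_pow_right₀ (by norm_num) hkk') hs.le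
  have hτles : ∀ k, τ k ≤ s := fun k => by
    rw [hτ]; exact mul_le_of_one_le_left hs.le (one_le_pow₀ (by norm_num))
  obtain ⟨κ₀, hκ₀⟩ : ∃ κ₀ : ℝ, κ₀ = 2 * ρ + 2 * D + 2 := ⟨_, rfl⟩
  have hκ₀pos : 0 < κ₀ := by rw [hκ₀]; positivity
  have hκ₀two : 2 ≤ κ₀ := by rw [hκ₀]; linarith
  -- the scale `ℓ₀ 6^{k}` of the statement is `κ₀ · Lk k`
  have hscale : ∀ k : ℕ, (2 * ρ + 2 * D + 2) * Real.sqrt (-s) * 6 ^ k = κ₀ * Lk k := by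
    intro k; rw [hκ₀, hL, hL0]; ring
  -- ### the number of scales `m`, chosen BEFORE `μ, P, x₀, L, k`
  obtain ⟨E', hE'0, hEE'⟩ : ∃ E' : ℝ, 0 ≤ E' ∧ E ≤ E' := ⟨max E 0, le_max_right _ _, le_max_left _ _⟩
  obtain ⟨m₀, hm₀⟩ : ∃ m₀ : ℕ, E' * (ρ + D + 2) * κ₀ / (C * c) ≤ (m₀ : ℝ) := ⟨_, Nat.le_ceil _⟩
  refine ⟨m₀ + 1, ?_⟩
  intro μ P x₀ L k hk hkL hconf hPer hSp hBud
  have hm1 : 0 < m₀ + 1 := Nat.succ_pos _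
  -- the radius is positive and dominates every used epoch length
  have hLkle : ∀ j, j < m₀ + 1 → κ₀ * Lk (k j) ≤ L := fun j hj => by rw [← hscale]; exact hkL j hj
  have hLkle' : ∀ j, j < m₀ + 1 → Lk (k j) ≤ L := fun j hj => by
    have h1 := hLkle j hj
    nlinarith [hLpos (k j), hκ₀two]
  have hLpos' : 0 < L := lt_of_lt_of_le (mul_pos hκ₀pos (hLpos (k 0))) (hLkle 0 hm1)
  -- ### iterated backward propagation with parabolic drift `≤ ρ Lk k`
  have hiter : ∀ (n : ℕ) (z : E3), P s z → ∃ x : E3, ‖x - z‖ ≤ ρ * Lk n ∧ P (τ n) x := by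
    intro n
    induction n with
    | zero =>
      intro z hz
      refine ⟨z, ?_, ?_⟩
      · rw [sub_self, norm_zero]; exact (mul_pos hρ (hLpos 0)).le
      · rw [hτ]; simpa using hz
    | succ n ih =>
      intro z hz
      obtain ⟨x, hxz, hPx⟩ := ih z hz
      obtain ⟨x', hx'x, hPx'⟩ := hPer (τ n) x (hτneg n) hPx
      refine ⟨x', ?_, ?_⟩
      · rw [hsqrtτ n] at hx'x
        have h6 : Lk (n + 1) = 6 * Lk n := by rw [hL, hL, pow_succ]; ring
        calc ‖x' - z‖ ≤ ‖x' - x‖ + ‖x - z‖ := norm_sub_le_norm_sub_add_norm_sub _ _ _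
          _ ≤ ρ * Lk n + ρ * Lk n := add_le_add hx'x hxz
          _ ≤ ρ * Lk (n + 1) := by rw [h6]; nlinarith [hLpos n, hρ]
      · have e : 36 * τ n = τ (n + 1) := by rw [hτ, hτ, pow_succ]; ring
        rw [← e]; exact hPx'
  -- ### the crowded finite sets (guarded by `j < m₀+1`) and their propagated level points
  have hS : ∀ j : ℕ, ∃ S : Finset E3, j < m₀ + 1 →
      (C * L / (κ₀ * Lk (k j)) ≤ (S.card : ℝ) ∧ (∀ z ∈ S, ‖z - x₀‖ ≤ L ∧ P s z) ∧
        (∀ z ∈ S, ∀ z' ∈ S, z ≠ z' → κ₀ * Lk (k j) ≤ ‖z - z'‖)) := by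
    intro j
    by_cases hj : j < m₀ + 1
    · obtain ⟨S, h1, h2, h3⟩ := hconf j hj
      refine ⟨S, fun _ => ⟨?_, h2, fun z hz z' hz' hzz => ?_⟩⟩
      · rw [← hscale]; exact h1
      · rw [← hscale]; exact h3 z hz z' hz' hzz
    · exact ⟨∅, fun h' => absurd h' hj⟩
  choose S hS using hS
  have hx : ∀ (j : ℕ) (z : E3), ∃ x : E3, j < m₀ + 1 → z ∈ S j → ‖x - z‖ ≤ ρ * Lk (k j) ∧ P (τ (k j)) x := by
    intro j z
    by_cases h : j < m₀ + 1 ∧ z ∈ S j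
    · obtain ⟨x, h1, h2⟩ := hiter (k j) z ((hS j h.1).2.1 z h.2).2
      exact ⟨x, fun _ _ => ⟨h1, h2⟩⟩
    · exact ⟨x₀, fun h1 h2 => absurd ⟨h1, h2⟩ h⟩
  choose x hx using hx
  -- ### the boxes
  obtain ⟨B, hB⟩ : ∃ B : ℕ → E3 → Set (ℝ × E3),
      ∀ j z, B j z = Set.Icc ((1 + a) * τ (k j)) (τ (k j)) ×ˢ Metric.ball (x j z) (D * Lk (k j)) := ⟨_, fun _ _ => rfl⟩
  have hBmeas : ∀ j z, MeasurableSet (B j z) := fun j z => by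
    rw [hB]; exact measurableSet_Icc.prod measurableSet_ball
  have hBspend : ∀ j z, j < m₀ + 1 → z ∈ S j → ENNReal.ofReal (c * Lk (k j)) ≤ μ (B j z) := by
    intro j z hj hz
    have h := hSp (τ (k j)) (x j z) (hτneg (k j)) (hx j z hj hz).2
    rw [hsqrtτ (k j)] at h
    rw [hB]; exact h
  -- separation within a scale
  have hsep : ∀ j z z', j < m₀ + 1 → z ∈ S j → z' ∈ S j → z ≠ z' →
      Disjoint (Metric.ball (x j z) (D * Lk (k j))) (Metric.ball (x j z') (D * Lk (k j))) := by
    intro j z z' hj hz hz' hzz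
    apply Metric.ball_disjoint_ball
    have h1 := (hS j hj).2.2 z hz z' hz' hzz
    have hxx : ‖z - z'‖ ≤ ‖x j z - x j z'‖ + ρ * Lk (k j) + ρ * Lk (k j) := by
      have e : z - z' = (x j z - x j z') - (x j z - z) + (x j z' - z') := by abel
      rw [e]
      calc ‖(x j z - x j z') - (x j z - z) + (x j z' - z')‖
          ≤ ‖(x j z - x j z') - (x j z - z)‖ + ‖x j z' - z'‖ := norm_add_le _ _
        _ ≤ ‖x j z - x j z'‖ + ‖x j z - z‖ + ‖x j z' - z'‖ := by
            gcongr; exact norm_sub_le _ _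
        _ ≤ _ := by linarith [(hx j z hj hz).1, (hx j z' hj hz').1]
    rw [dist_eq_norm]
    have e := hκ₀
    nlinarith [hLpos (k j), hD]
  -- separation of the time intervals across epochs
  have htime : ∀ n n' : ℕ, n < n' → Disjoint (Set.Icc ((1 + a) * τ n) (τ n)) (Set.Icc ((1 + a) * τ n') (τ n')) := by
    intro n n' hnn'
    rw [Set.disjoint_left]
    intro p hp hp'
    have h1 : τ n' ≤ 36 * τ n := by
      have e : 36 * τ n = τ (n + 1) := by rw [hτ, hτ, pow_succ]; ring
      rw [e]; exact hτmono (Nat.succ_le_of_lt hnn')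
    have h2 : 36 * τ n < (1 + a) * τ n := by nlinarith [hτneg n]
    linarith [hp.1, hp'.2, h1, h2]
  -- ### the index set: scales `j < m₀+1`, points `z ∈ S j`
  obtain ⟨I, hI⟩ : ∃ I : Finset ((_ : ℕ) × E3), I = (Finset.range (m₀ + 1)).sigma fun j => S j := ⟨_, rfl⟩
  have hmemI : ∀ p ∈ I, p.1 < m₀ + 1 ∧ p.2 ∈ S p.1 := by
    intro p hp
    rw [hI, Finset.mem_sigma, Finset.mem_range] at hp
    exact hp
  have hpd : Set.PairwiseDisjoint (↑I : Set ((_ : ℕ) × E3)) (fun p => B p.1 p.2) := by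
    intro p hp q hq hpq
    have hp' := hmemI p (Finset.mem_coe.1 hp)
    have hq' := hmemI q (Finset.mem_coe.1 hq)
    obtain ⟨j, z⟩ := p
    obtain ⟨j', z'⟩ := q
    show Disjoint (B j z) (B j' z')
    rw [hB, hB, Set.disjoint_prod]
    rcases lt_trichotomy (k j) (k j') with hlt | heq | hgt
    · exact Or.inl (htime _ _ hlt)
    · have hjj : j = j' := hk.injective heq
      subst hjj
      right
      have hzz : z ≠ z' := by
        intro h; subst h; exact hpq rfl
      exact hsep j z z' hp'.1 hp'.2 hq'.2 hzz
    · exact Or.inl (htime _ _ hgt).symm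
  -- ### every box lies in the big cylinder `[(1+a) τ (k m₀), s] × B(x₀, R)`, `R = (ρ+D+2) L`
  obtain ⟨R, hR⟩ : ∃ R : ℝ, R = (ρ + D + 2) * L := ⟨_, rfl⟩
  have hRL : L ≤ R := by rw [hR]; nlinarith [hLpos', hρ, hD]
  have hRpos : 0 < R := hLpos'.trans_le hRL
  have hkmono : ∀ j, j < m₀ + 1 → k j ≤ k m₀ := fun j hj => hk.monotone (Nat.le_of_lt_succ hj)
  have hBsub : ∀ p ∈ I, B p.1 p.2 ⊆ Set.Icc ((1 + a) * τ (k m₀)) s ×ˢ Metric.ball x₀ R := by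
    intro p hp
    obtain ⟨hj, hz⟩ := hmemI p hp
    rw [hB]
    refine Set.prod_mono (Set.Icc_subset_Icc ?_ (hτles _)) ?_
    · exact mul_le_mul_of_nonneg_left (hτmono (hkmono p.1 hj)) (by linarith)
    · apply Metric.ball_subset_ball'
      rw [dist_eq_norm]
      have hxle : ‖x p.1 p.2 - x₀‖ ≤ ‖x p.1 p.2 - p.2‖ + ‖p.2 - x₀‖ := norm_sub_le_norm_sub_add_norm_sub _ _ _
      have h1 := (hx p.1 p.2 hj hz).1
      have h2 := ((hS p.1 hj).2.1 p.2 hz).1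
      have h3 := hLkle' p.1 hj
      rw [hR]
      nlinarith [hD, hρ, hLpos (k p.1)]
  -- ### the ledger inequality in `ℝ≥0∞`, then in `ℝ`
  have hτ1s : (1 + a) * τ (k m₀) < s := by
    have h1 : (1 + a) * τ (k m₀) < τ (k m₀) := by nlinarith [hτneg (k m₀)]
    exact h1.trans_le (hτles _)
  have hτR : -((1 + a) * τ (k m₀)) ≤ R ^ 2 := by
    have h1 : -((1 + a) * τ (k m₀)) = (1 + a) * Lk (k m₀) ^ 2 := by rw [hLsq]; ring
    have h2 : 2 * Lk (k m₀) ≤ R := by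
      have h3 := hLkle m₀ (Nat.lt_succ_self _)
      nlinarith [hLpos (k m₀), hκ₀two, hRL]
    have h3 : (2 * Lk (k m₀)) ^ 2 ≤ R ^ 2 := pow_le_pow_left₀ (by linarith [hLpos (k m₀)]) h2 2
    have h4 : (1 + a) * Lk (k m₀) ^ 2 ≤ (2 * Lk (k m₀)) ^ 2 := by
      rw [show (2 * Lk (k m₀)) ^ 2 = 4 * Lk (k m₀) ^ 2 by ring]
      exact mul_le_mul_of_nonneg_right (by linarith) (sq_nonneg _)
    rw [h1]; linarith
  have key : ENNReal.ofReal (∑ p ∈ I, c * Lk (k p.1)) ≤ ENNReal.ofReal (E' * R) := by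
    calc ENNReal.ofReal (∑ p ∈ I, c * Lk (k p.1))
        = ∑ p ∈ I, ENNReal.ofReal (c * Lk (k p.1)) :=
          ENNReal.ofReal_sum_of_nonneg fun p _ => (mul_pos hc (hLpos _)).le
      _ ≤ ∑ p ∈ I, μ (B p.1 p.2) := Finset.sum_le_sum fun p hp => hBspend p.1 p.2 (hmemI p hp).1 (hmemI p hp).2
      _ = μ (⋃ p ∈ I, B p.1 p.2) := (measure_biUnion_finset hpd fun p _ => hBmeas p.1 p.2).symm
      _ ≤ μ (Set.Icc ((1 + a) * τ (k m₀)) s ×ˢ Metric.ball x₀ R) :=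
          measure_mono (Set.iUnion₂_subset fun p hp => hBsub p hp)
      _ ≤ ENNReal.ofReal (E * R) := hBud R _ _ hRpos hτ1s hs hτR
      _ ≤ ENNReal.ofReal (E' * R) := ENNReal.ofReal_le_ofReal (mul_le_mul_of_nonneg_right hEE' hRpos.le)
  have hSum : ∑ p ∈ I, c * Lk (k p.1) = ∑ j ∈ Finset.range (m₀ + 1), ((S j).card : ℝ) * (c * Lk (k j)) := by
    rw [hI, Finset.sum_sigma]
    refine Finset.sum_congr rfl fun j _ => ?_
    show ∑ z ∈ S j, c * Lk (k j) = _
    rw [Finset.sum_const, nsmul_eq_mul]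
  -- per-scale spending `≥ C c L / κ₀`
  have hep : ∀ j ∈ Finset.range (m₀ + 1), C * c * L / κ₀ ≤ ((S j).card : ℝ) * (c * Lk (k j)) := by
    intro j hj
    have hj' : j < m₀ + 1 := Finset.mem_range.1 hj
    have h1 := (hS j hj').1
    have h2 : 0 < κ₀ * Lk (k j) := mul_pos hκ₀pos (hLpos _)
    rw [div_le_iff₀ h2] at h1
    rw [div_le_iff₀ hκ₀pos]
    nlinarith [h1, hc, hLpos (k j)]
  have hSge : ((m₀ : ℝ) + 1) * (C * c * L / κ₀) ≤ ∑ p ∈ I, c * Lk (k p.1) := by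
    rw [hSum]
    have h := Finset.sum_le_sum hep
    rw [Finset.sum_const, Finset.card_range, nsmul_eq_mul] at h
    push_cast at h
    linarith
  -- the contradiction
  have hfin : ∑ p ∈ I, c * Lk (k p.1) ≤ E' * R ∨ ∑ p ∈ I, c * Lk (k p.1) ≤ 0 := ENNReal.ofReal_le_ofReal_iff'.1 key
  have hq : 0 < C * c * L / κ₀ := by positivity
  have hgap : E' * R < ((m₀ : ℝ) + 1) * (C * c * L / κ₀) := by
    have h1 : E' * (ρ + D + 2) * κ₀ ≤ (m₀ : ℝ) * (C * c) := by
      have h2 := hm₀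
      rw [div_le_iff₀ (mul_pos hC hc)] at h2
      exact h2
    have h3 : E' * R = (E' * (ρ + D + 2) * κ₀) * (L / κ₀) := by
      rw [hR]; field_simp
    have h4 : ((m₀ : ℝ) + 1) * (C * c * L / κ₀) = ((m₀ : ℝ) * (C * c)) * (L / κ₀) + C * c * L / κ₀ := by ring
    have h5 : 0 < L / κ₀ := div_pos hLpos' hκ₀pos
    rw [h3, h4]
    nlinarith [mul_le_mul_of_nonneg_right h1 h5.le, hq]
  have hERnn : 0 ≤ E' * R := mul_nonneg hE'0 hRpos.le
  rcases hfin with h | h <;> nlinarith [hSge, hgap, hq]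

/-- The local crowding Liouville theorem from the two ANALYTIC stubs only (L3ᵐˢ proved above). -/
theorem localCrowdingLiouville_of (hL1 : UniformDissipationBudget) (hL2 : ViolatorDissipation) : LocalCrowdingLiouville :=
  localCrowdingLiouville_of_ledger multiscaleLedgerCount_holds hL1 hL2

/-! ## §3 The three registered stubs (T♭ heart · L1ᵘ · L2) and their registration-style names -/

/-- REGISTERED STUB T♭ (heart, XL). -/
theorem stub_tightOrCrowding : TightOrCrowding := by
  sorry

/-- REGISTERED STUB L1ᵘ (L; same statement as g10-β's `stub_uniformDissipationBudget`). -/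
theorem stub_uniformDissipationBudget : UniformDissipationBudget := by
  sorry

/-- REGISTERED STUB L2 (M; same statement as g10-α/β's `stub_violatorDissipation`). -/
theorem stub_violatorDissipation : ViolatorDissipation := by
  sorry

/-! Registration-style names: the skeleton's hypotheses are typed by these abbreviations (head constant = a `stub_*` name). -/
namespace Registered

/-- = `TightOrCrowding`. -/
abbrev stub_tightOrCrowding : Prop := TightOrCrowding
/-- = `UniformDissipationBudget`. -/
abbrev stub_uniformDissipationBudget : Prop := UniformDissipationBudget
/-- = `ViolatorDissipation`. -/
abbrev stub_violatorDissipation : Prop := ViolatorDissipation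

end Registered

/-! ## §4 THE SKELETON: T♭ + L1ᵘ + L2 ⇒ the crux BY NAME (kernel-checked, no `sorry` outside the three stubs; F1, T0, T2′, G′, L3ᵐˢ, the
propagation and the extremal-branch exclusion are theorems) -/

/-- **LINE g10-γ SKELETON — the crux from the three stubs T♭, L1ᵘ, L2 (via the local crowding Liouville theorem).**  Violator frame by
contradiction → F1 budget `A` (`flowFilamentBudget`) → T0 data (`efficientTimesNoDust_holds`) → T2′ zoom family + flow compactness
(`zoomPackageFlow`) → eventual growth of the members (`ballEnergy_zoom_le`) → T♭: centres, subsequence, limit `W₀`, dichotomy → flow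
compactness at those centres: `W₀ = W s`, `W` Type-I ancient mild → G′ (`growthTransferFlow`): all-time growth → tight branch:
`not_isExtremalSlice_of_typeIAncientMild`; crowding branch: `LocalCrowdingLiouville` at `(m, ℓ₀)(K, A, C, η, s)`. -/
theorem NearExtremalTransiencePerFlow_of
    (hT : Registered.stub_tightOrCrowding)
    (hL1 : Registered.stub_uniformDissipationBudget) (hL2 : Registered.stub_violatorDissipation) :
    NearExtremalTransiencePerFlow := by
  have hL : LocalCrowdingLiouville := localCrowdingLiouville_of hL1 hL2
  have hT0 : EfficientTimesNoDust := efficientTimesNoDust_holds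
  intro C ν T hC hν hT' u p hsol hLH hdec hrate hsing
  by_contra hno
  have hV : IsViolator C ν T u p := ⟨hC, hν, hT', hsol, hLH, hdec, hrate, hsing, hno⟩
  obtain ⟨A, hA⟩ := FilamentGap.flowFilamentBudget C ν T hC hν hT' u p hsol hLH hdec hrate
  obtain ⟨Θ, t, Mb, ε, hdata⟩ := hT0 C ν T u p hV
  obtain ⟨σ, Λ, Θ', ε', hσ, hfam, hcompF⟩ := FilamentSelection.zoomPackageFlow C ν T u p hV Θ t Mb ε hdata
  set V : ℕ → E3 → E3 := fun n z => (Mb (σ n))⁻¹ • u (t (σ n)) ((ν / Mb (σ n)) • z) with hVdef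
  have htT : Tendsto (fun n => t (σ n)) atTop (𝓝[<] T) := by
    have h1 : Tendsto (fun n => t (σ n)) atTop (𝓝 T) := hdata.2.1.comp hσ.tendsto_atTop
    exact tendsto_nhdsWithin_iff.2 ⟨h1, Eventually.of_forall fun n => (hdata.1 (σ n)).2⟩
  have hgrV : ∀ᶠ n in atTop, ∀ (x : E3) (R : ℝ), 0 < R → ∫ z in Metric.ball x R, ‖V n z‖ ^ 2 ≤ A * R := by
    filter_upwards [htT.eventually hA] with n hn x R hR
    have h := FilamentSelection.ballEnergy_zoom_le hν (hdata.2.2.2.1 (σ n)) hn 0 x hR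
    simpa only [zero_add] using h
  obtain ⟨y, φ, W₀, hφ, hconv, hdich⟩ := hT V Λ Θ' ε' A hfam hgrV
  obtain ⟨ψ, K, s, W, hψ, hW, hs, hpin, hconvF⟩ := hcompF y φ hφ
  have hconv' : ∀ z : E3, Tendsto (fun n => V (φ (ψ n)) (y (φ (ψ n)) + z)) atTop (𝓝 (W s z)) := by
    intro z
    have h1 := hconvF s hs z
    simp only [sub_self, mul_zero, add_zero] at h1
    exact h1
  have hWs : W s = W₀ :=
    funext fun z => tendsto_nhds_unique (hconv' z) ((hconv z).comp hψ.tendsto_atTop)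
  subst hWs
  have htT' : Tendsto (fun n => t (σ (φ (ψ n)))) atTop (𝓝 T) :=
    hdata.2.1.comp ((hσ.comp (hφ.comp hψ)).tendsto_atTop)
  have hgrowthAll : HasLinGrowthAllTime A W := by
    intro τ hτ
    exact FilamentSelection.growthTransferFlow ν A T u (fun n => t (σ (φ (ψ n)))) (fun n => Mb (σ (φ (ψ n))))
      (fun n => y (φ (ψ n))) s τ (W τ) hν hT' (fun n => hdata.2.2.2.1 _) (fun n => (hdata.1 _).2) htT'
      (fun t' ht' => (hsol.contDiff_velocity ht').continuous) hA hs hpin hτ (hconvF τ hτ)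
  rcases hdich with hext | ⟨C', η, hC', hη, hcrowd⟩
  · exact not_isExtremalSlice_of_typeIAncientMild hW hs hext
  · obtain ⟨m, ℓ₀, hℓ₀, hLm⟩ := hL K A C' η s hs hC' hη
    exact hLm W hW hgrowthAll (hcrowd m ℓ₀ hℓ₀)

/-- Sanity: the skeleton applied to the three `sorry`-stubs elaborates and concludes the route decl (an `example`, so that the skeleton
theorem above is the ONLY declaration concluding the crux). -/
example : NearExtremalTransiencePerFlow :=
  NearExtremalTransiencePerFlow_of stub_tightOrCrowding stub_uniformDissipationBudget stub_violatorDissipation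

end Summit.NavierStokesRegularity.NavierStokesRegularity.Cruxes.NearExtremalTransiencePerFlow.MultiscaleCrowding

end
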